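import Summits.AnomalousDissipation.AnomalousDissipation.Theses.PumpedMirror
import Literature.Analysis.FluidPDE.NSHopfLimit
import Summits.AnomalousDissipation.AnomalousDissipation.Theorems.PumpedMirrorMirrorBoundedFromRestTGTransient

/-!
# Strategy census — typed companion, crux `PumpedMirror.MirrorBoundedFromRestTG`
# (stmt-AnomalousDissipation-15373; crux-strategist `planner-cstrat-stmt-AnomalousDissipation-15373-b1-0`, 2026-08-17)

Kernel-checked facts quoted by `Cruxes/MirrorBoundedFromRestTG/STRATEGY-CENSUS.md`. Nothing here asserts a
Theses statement; no `sorry`.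

* §1 `crux_iff` — the sugar binder `∀ f, f = f_TG →` stripped.
* §2 `mirrorMeanBoundedFamilyTG_of_crux` — B (pathwise, from rest) implies the sibling route's datum-free MEAN
  crux `MirrorEnsemble.MirrorMeanBoundedFamilyTG` (stmt-AnomalousDissipation-17694; stated here as a verbatim copy): B sits ABOVE the necessary
  core of every f_TG-in-Fix-K route by exactly "rest datum + sup-in-time instead of Cesàro".
* §3 `not_crux_iff` — the shape of any disproof: UNIVERSAL escape of every K-symmetric Leray–Hopf path from rest.
* §4 Galerkin level (the live line's currency): `galerkin_excursion_le` — along an exact-force Hopf–Galerkin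
  scheme for `(ν, f_TG, 0)`, `∫|U n t|² ≤ 2 ∫|U n s|² + (t - s)²` for `0 ≤ s ≤ t` (energy identity on `[s,t]`,
  Young, maximum on `[s,t]`); `lateCeiling_of_recurrentReturn` — if after `T₀` the Galerkin energy RETURNS below
  `E₁` at least once in every window of length `τ`, then it is `≤ 2 E₁ + τ²` for all `t ≥ T₀ + τ`: the PATHWISE
  surcharge of the open stub `stub_galerkinLateCeilingFromRest` over a recurrence / windowed-mean statement is free;
  `galerkin_return_of_windowMean` — windowed means give returns (first-moment principle).
* §5 typed targets (NOT proved): the full Taylor–Green group `G` (`gAct`, `hAct`, `IsGSymm`), the `Fix G` scheme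
  from rest, the heart in `Fix G` (`LateCeilingFixG`) and in recurrence form (`RecurrentReturnFromRest`), and the
  kernel-checked reduction `stub_galerkinLateCeilingFromRest_of_recurrentReturn` of the live open stub to the latter.
-/

noncomputable section

open MeasureTheory Filter Set Function
open scoped InnerProductSpace ENNReal Topology

set_option linter.dupNamespace false

namespace Summit.AnomalousDissipation.AnomalousDissipation.Cruxes.MirrorBoundedFromRestTG.StrategyCensus

open Literature.Analysis.FunctionSpaces Literature.Analysis.FluidPDE
open Summit.AnomalousDissipation.AnomalousDissipation.Theses

/-- The pinned Taylor–Green force, verbatim the crux's lambda term. -/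
def fTG : UnitAddTorus (Fin 3) → EuclideanSpace ℝ (Fin 3) :=
  fun x => !₂[(fourier 1 (x 0) : ℂ).im * (fourier 1 (x 1) : ℂ).re * (fourier 1 (x 2) : ℂ).re,
    -((fourier 1 (x 0) : ℂ).re * (fourier 1 (x 1) : ℂ).im * (fourier 1 (x 2) : ℂ).re), (0 : ℝ)]

/-- Local shorthand for the a.e. mirror symmetry of an `H`-valued slice. -/
def IsMirrorAE (V : Torus.energySpace (Fin 3)) : Prop :=
  ∀ i j : Fin 3,
    (fun x => ((V : Lp (EuclideanSpace ℝ (Fin 3)) 2 (volume : Measure (UnitAddTorus (Fin 3)))) :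
      UnitAddTorus (Fin 3) → EuclideanSpace ℝ (Fin 3)) (Function.update x i (-x i)) j) =ᵐ[volume]
    (fun x => if j = i then
      -(((V : Lp (EuclideanSpace ℝ (Fin 3)) 2 (volume : Measure (UnitAddTorus (Fin 3)))) :
        UnitAddTorus (Fin 3) → EuclideanSpace ℝ (Fin 3)) x j)
      else ((V : Lp (EuclideanSpace ℝ (Fin 3)) 2 (volume : Measure (UnitAddTorus (Fin 3)))) :
        UnitAddTorus (Fin 3) → EuclideanSpace ℝ (Fin 3)) x j)

/-- The body of the crux at the pinned force: `∃ E ν₁ > 0, ∀ ν ∈ (0, ν₁)`, SOME global Leray–Hopf solution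
from rest with a K-symmetric `H`-lift obeys `‖U t‖² ≤ E` for all `t ≥ 0`. -/
def Body : Prop :=
  ∃ (E ν₁ : ℝ), 0 < E ∧ 0 < ν₁ ∧ ∀ ν : ℝ, 0 < ν → ν < ν₁ →
    ∃ (u : ℝ → UnitAddTorus (Fin 3) → EuclideanSpace ℝ (Fin 3)) (U : ℝ → Torus.energySpace (Fin 3)),
      Torus.IsGlobalLerayHopf ν (fun _ => fTG) 0 u ∧
      (∀ t, 0 ≤ t → ((U t : Lp (EuclideanSpace ℝ (Fin 3)) 2 (volume : Measure (UnitAddTorus (Fin 3)))) :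
        UnitAddTorus (Fin 3) → EuclideanSpace ℝ (Fin 3)) =ᵐ[volume] u t) ∧
      (∀ t, 0 ≤ t → IsMirrorAE (U t)) ∧ (∀ t, 0 ≤ t → ‖U t‖ ^ 2 ≤ E)

/-! ## §1 The crux, unfolded -/

theorem crux_iff : PumpedMirror.MirrorBoundedFromRestTG ↔ Body := by
  constructor
  · intro h
    obtain ⟨E, ν₁, hE, hν₁, h⟩ := h fTG rfl
    exact ⟨E, ν₁, hE, hν₁, fun ν hν hνlt => h ν hν hνlt⟩
  · rintro ⟨E, ν₁, hE, hν₁, h⟩ f hf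
    subst hf
    exact ⟨E, ν₁, hE, hν₁, fun ν hν hνlt => h ν hν hνlt⟩

/-! ## §2 B implies the sibling's datum-free MEAN crux `MirrorEnsemble.MirrorMeanBoundedFamilyTG` -/

/-- Character-for-character copy of `Summit.AnomalousDissipation.AnomalousDissipation.Theses.MirrorEnsemble.MirrorMeanBoundedFamilyTG`
(stmt-AnomalousDissipation-17694; `MirrorMeanBoundedFamilyTG_copy ↔ MirrorEnsemble.MirrorMeanBoundedFamilyTG` is `Iff.rfl` — the folder
file `StrategyCensusFull.lean` (rc 0) imports both Theses and proves B → the original decl directly; this crux-dir copy does not import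
`Theses.MirrorEnsemble` because the farm reported that module incoherent at publish time). -/
def MirrorMeanBoundedFamilyTG_copy : Prop :=
  ∀ f : UnitAddTorus (Fin 3) → EuclideanSpace ℝ (Fin 3), f = (fun x => !₂[(fourier 1 (x 0) : ℂ).im * (fourier 1 (x 1) : ℂ).re * (fourier 1 (x 2) : ℂ).re, -((fourier 1 (x 0) : ℂ).re * (fourier 1 (x 1) : ℂ).im * (fourier 1 (x 2) : ℂ).re), (0 : ℝ)]) → ∃ (E : ℝ) (ν : ℕ → ℝ) (u₀ : ℕ → UnitAddTorus (Fin 3) → EuclideanSpace ℝ (Fin 3)) (u : ℕ → ℝ → UnitAddTorus (Fin 3) → EuclideanSpace ℝ (Fin 3)) (U : ℕ → ℝ → Literature.Analysis.FunctionSpaces.Torus.energySpace (Fin 3)), (∀ j, 0 < ν j) ∧ Filter.Tendsto ν Filter.atTop (nhds 0) ∧ (∀ j, Literature.Analysis.FluidPDE.Torus.IsGlobalLerayHopf (ν j) (fun _ => f) (u₀ j) (u j)) ∧ (∀ j t, 0 ≤ t → ((U j t : MeasureTheory.Lp (EuclideanSpace ℝ (Fin 3)) 2 (MeasureTheory.volume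 : MeasureTheory.Measure (UnitAddTorus (Fin 3)))) : UnitAddTorus (Fin 3) → EuclideanSpace ℝ (Fin 3)) =ᵐ[MeasureTheory.volume] u j t) ∧ (∀ j t, 0 ≤ t → ∀ i i' : Fin 3, (fun x => ((U j t : MeasureTheory.Lp (EuclideanSpace ℝ (Fin 3)) 2 (MeasureTheory.volume : MeasureTheory.Measure (UnitAddTorus (Fin 3)))) : UnitAddTorus (Fin 3) → EuclideanSpace ℝ (Fin 3)) (Function.update x i (-x i)) i') =ᵐ[MeasureTheory.volume] (fun x => if i' = i then -(((U j t : MeasureTheory.Lp (EuclideanSpace ℝ (Fin 3)) 2 (MeasureTheory.volume : MeasureTheory.Measure (UnitAddTorus (Fin 3)))) : UnitAddTorus (Fin 3) → EuclideanSpace ℝ (Fin 3)) x i') else ((U j t : MeasureTheory.Lp (EuclideanSpace ℝ (Fin 3)) 2 (MeasureTheory.volume : MeasureTheory.Measure (UnitAddTorus (Fin 3)))) : UnitAddTorus (Fin 3) → EuclideanSpace ℝ (Fin 3)) x i')) ∧ ∀ j, Literature.Analysis.FluidPDE.meanEnergy (u j) ≤ E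


/-- A pathwise bound on the lift is a bound on the long-time mean energy (the `hEn` block of
`PumpedMirror.closes`). -/
theorem meanEnergy_le_of_lift_bound {u : ℝ → UnitAddTorus (Fin 3) → EuclideanSpace ℝ (Fin 3)}
    {U : ℝ → Torus.energySpace (Fin 3)} {E : ℝ}
    (hl : ∀ t, 0 ≤ t → ((U t : Lp (EuclideanSpace ℝ (Fin 3)) 2 (volume : Measure (UnitAddTorus (Fin 3)))) :
        UnitAddTorus (Fin 3) → EuclideanSpace ℝ (Fin 3)) =ᵐ[volume] u t)
    (hbd : ∀ t, 0 ≤ t → ‖U t‖ ^ 2 ≤ E) :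
    meanEnergy u ≤ E := by
  have hg : ∀ t, 0 ≤ t → |∫ x, ‖u t x‖ ^ 2| ≤ E := by
    intro t ht
    have h1 : ‖U t‖ ^ 2 = ∫ x, ‖u t x‖ ^ 2 := by
      rw [Submodule.coe_norm, ← real_inner_self_eq_norm_sq, L2.inner_def]
      refine integral_congr_ae ?_
      filter_upwards [hl t ht] with x hx
      rw [hx, real_inner_self_eq_norm_sq]
    rw [abs_of_nonneg (integral_nonneg fun x => by positivity), ← h1]
    exact hbd t ht
  have hTM : ∀ T, 0 < T → |timeMean (fun t => ∫ x, ‖u t x‖ ^ 2) T| ≤ E :=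
    fun T hT => abs_timeMean_le hT fun t ht _ => hg t ht.le
  rw [meanEnergy_eq_longTimeAvgSup]
  exact limsup_le_of_le
    (isCoboundedUnder_le_of_eventually_le atTop
      ((eventually_gt_atTop 0).mono fun T hT => (abs_le.1 (hTM T hT)).1))
    ((eventually_gt_atTop 0).mono fun T hT => (abs_le.1 (hTM T hT)).2)

/-- **B ⟹ B_K.** The pathwise bounded mirror family from rest gives the sibling route's mean-bounded mirror
family (viscosities `ν_j = ν₁/(j+2)`, data `0`). -/
theorem mirrorMeanBoundedFamilyTG_of_crux (h : PumpedMirror.MirrorBoundedFromRestTG) :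
    MirrorMeanBoundedFamilyTG_copy := by
  intro f hf
  obtain ⟨E, ν₁, hE, hν₁, hfam⟩ := h f hf
  set ν : ℕ → ℝ := fun j => ν₁ / ((j : ℝ) + 2) with hν
  have hνp : ∀ j, 0 < ν j := fun j => div_pos hν₁ (by positivity)
  have hνlt : ∀ j, ν j < ν₁ := fun j => by
    rw [hν, div_lt_iff₀ (by positivity : (0 : ℝ) < j + 2)]; nlinarith
  have hνlim : Tendsto ν atTop (nhds 0) := by
    simpa [hν, div_eq_mul_inv] using (tendsto_inv_atTop_zero.comp
      (tendsto_atTop_add_const_right atTop (2 : ℝ) tendsto_natCast_atTop_atTop)).const_mul ν₁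
  choose u U hLH hl hsym hbd using fun j => hfam (ν j) (hνp j) (hνlt j)
  refine ⟨E, ν, fun _ => 0, u, U, hνp, hνlim, hLH, fun j t ht => hl j t ht, fun j t ht => hsym j t ht,
    fun j => meanEnergy_le_of_lift_bound (hl j) (hbd j)⟩

/-! ## §3 The shape of a disproof -/

/-- `¬B` is a UNIVERSAL escape statement: for every level `E` and threshold `ν₁` there is a viscosity below the
threshold at which EVERY global Leray–Hopf solution from rest with a K-symmetric `H`-lift leaves the ball
`{‖U t‖² ≤ E}` at some time. -/
theorem not_crux_iff : ¬ PumpedMirror.MirrorBoundedFromRestTG ↔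
    ∀ E ν₁ : ℝ, 0 < E → 0 < ν₁ → ∃ ν : ℝ, 0 < ν ∧ ν < ν₁ ∧
      ∀ (u : ℝ → UnitAddTorus (Fin 3) → EuclideanSpace ℝ (Fin 3)) (U : ℝ → Torus.energySpace (Fin 3)),
        Torus.IsGlobalLerayHopf ν (fun _ => fTG) 0 u →
        (∀ t, 0 ≤ t → ((U t : Lp (EuclideanSpace ℝ (Fin 3)) 2 (volume : Measure (UnitAddTorus (Fin 3)))) :
          UnitAddTorus (Fin 3) → EuclideanSpace ℝ (Fin 3)) =ᵐ[volume] u t) →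
        (∀ t, 0 ≤ t → IsMirrorAE (U t)) → ∃ t, 0 ≤ t ∧ E < ‖U t‖ ^ 2 := by
  rw [crux_iff]
  unfold Body
  push Not
  constructor
  · intro h E ν₁ hE hν₁
    obtain ⟨ν, hν, hνlt, h⟩ := h E ν₁ hE hν₁
    exact ⟨ν, hν, hνlt, fun u U hLH hl hsym => h u U hLH hl hsym⟩
  · intro h E ν₁ hE hν₁
    obtain ⟨ν, hν, hνlt, h⟩ := h E ν₁ hE hν₁
    exact ⟨ν, hν, hνlt, fun u U hLH hl hsym => h u U hLH hl hsym⟩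

/-! ## §4 Galerkin level: the pathwise surcharge is free (excursion control and recurrent returns) -/

section Galerkin

open Summit.AnomalousDissipation.AnomalousDissipation.Theorems.TaylorGreenLoudGalerkinStates.Negative
  (tgForce isSmooth_tgForce integral_norm_sq_tgForce)

variable {d : Type*} [Fintype d] [DecidableEq d]

/-- **Excursion control for exact-force Galerkin schemes** (any steady continuous force `f`, any datum, `ν ≥ 0`):
on every `[s, t] ⊆ [0, ∞)`, `∫ |U n t|² ≤ 2 ∫ |U n s|² + 4 (t - s)² ∫ |f|²` — the energy identity on `[s, t]`,
Young's inequality with `η = 1/(2(t-s))`, and the maximum of the continuous slice energy on `[s, t]`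
(Robinson–Rodrigo–Sadowski 2016, (4.8), started at `s` instead of `0`). In words: the energy of a Galerkin
trajectory cannot climb faster than the force can pump it, uniformly in `ν` and in the order. [folklore] -/
theorem galerkin_excursion_le {ν : ℝ} {f u₀ : UnitAddTorus d → EuclideanSpace ℝ d}
    {N : ℕ → ℕ} {U : ℕ → ℝ → UnitAddTorus d → EuclideanSpace ℝ d}
    (hS : IsHopfGalerkinScheme ν (fun _ => f) u₀ N (fun _ _ => f) U) (hν : 0 ≤ ν)
    (n : ℕ) {s t : ℝ} (hs : 0 ≤ s) (hst : s ≤ t) :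
    ∫ x, ‖U n t x‖ ^ 2 ≤ 2 * (∫ x, ‖U n s x‖ ^ 2) + 4 * (t - s) ^ 2 * ∫ x, ‖f x‖ ^ 2 := by
  have hF0 : 0 ≤ ∫ x, ‖f x‖ ^ 2 := integral_nonneg fun x => by positivity
  have hy0 : ∀ τ, 0 ≤ ∫ x, ‖U n τ x‖ ^ 2 := fun τ => integral_nonneg fun x => by positivity
  rcases eq_or_lt_of_le hst with rfl | hlt
  · nlinarith [hy0 s, hF0]
  -- continuity of the slice functionals on `[s, t]`
  have hUc := hS.continuousOn n
  have hFc := hS.continuousOn_force n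
  have hyc : ContinuousOn (fun τ => ∫ x, ‖U n τ x‖ ^ 2) (Icc s t) :=
    (Torus.continuousOn_integral_norm_sq_of_continuousOn_stLift hUc).mono fun τ hτ => mem_Ici.2 (hs.trans hτ.1)
  -- the maximum `Y` of the slice energy on `[s, t]`, attained at `t₁`
  obtain ⟨t₁, ht₁, hmax⟩ := isCompact_Icc.exists_isMaxOn (nonempty_Icc.2 hst) hyc
  set Y := ∫ x, ‖U n t₁ x‖ ^ 2 with hYdef
  have hY : ∀ τ ∈ Icc s t, ∫ x, ‖U n τ x‖ ^ 2 ≤ Y := fun τ hτ => hmax hτ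
  have hst₁ : s ≤ t₁ := ht₁.1
  have ht₁0 : 0 ≤ t₁ := hs.trans hst₁
  -- pointwise Young on `[s, t₁]` with `η = (2 (t - s))⁻¹`
  set η : ℝ := (2 * (t - s))⁻¹ with hηdef
  have hts : 0 < t - s := sub_pos.2 hlt
  have hη : 0 < η := by positivity
  have hPc : ContinuousOn (fun τ => ∫ x, ⟪(fun (_ : ℕ) (_ : ℝ) => f) n τ x, U n τ x⟫_ℝ) (Icc s t₁) :=
    (Torus.continuousOn_integral_inner_of_continuousOn_stLift hFc hUc).mono fun τ hτ => mem_Ici.2 (hs.trans hτ.1)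
  have hpt : ∀ τ ∈ Icc s t₁, ∫ x, ⟪(fun (_ : ℕ) (_ : ℝ) => f) n τ x, U n τ x⟫_ℝ ≤
      (2 * η)⁻¹ * (∫ x, ‖f x‖ ^ 2) + η / 2 * Y := by
    intro τ hτ
    have h := integral_inner_slice_le_young hFc hUc (hs.trans hτ.1) hη (t := τ)
    have h2 : η / 2 * ∫ x, ‖U n τ x‖ ^ 2 ≤ η / 2 * Y :=
      mul_le_mul_of_nonneg_left (hY τ ⟨hτ.1, hτ.2.trans ht₁.2⟩) (by positivity)
    exact h.trans (by simpa using add_le_add_left h2 ((2 * η)⁻¹ * ∫ x, ‖f x‖ ^ 2))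
  have hI : ∀ {g : ℝ → ℝ}, ContinuousOn g (Icc s t₁) → IntervalIntegrable g volume s t₁ :=
    fun hg => (hg.mono (by rw [uIcc_of_le hst₁])).intervalIntegrable
  have hW : ∫ τ in s..t₁, ∫ x, ⟪(fun (_ : ℕ) (_ : ℝ) => f) n τ x, U n τ x⟫_ℝ ≤
      (t₁ - s) * ((2 * η)⁻¹ * (∫ x, ‖f x‖ ^ 2) + η / 2 * Y) := by
    have h := intervalIntegral.integral_mono_on hst₁ (hI hPc) (hI continuousOn_const) hpt
    rwa [intervalIntegral.integral_const, smul_eq_mul] at h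
  -- the energy identity on `[s, t₁]`
  have hE := hS.energy_eq n s t₁ hs hst₁
  have hD : 0 ≤ ν * (∫⁻ τ in Ioo s t₁, Torus.eGradNormSq (U n τ)).toReal :=
    mul_nonneg hν ENNReal.toReal_nonneg
  simp only [Torus.kineticEnergy] at hE
  -- `(2η)⁻¹ = t - s`, and the Young remainder is at most `Y/4`
  have hη1 : (2 * η)⁻¹ = t - s := by rw [hηdef]; field_simp
  have hrem : (t₁ - s) * (η / 2 * Y) ≤ Y / 4 := by
    have hY0 : 0 ≤ Y := hy0 t₁
    have h1 : (t₁ - s) * (η / 2 * Y) = ((t₁ - s) / (t - s)) * (Y / 4) := by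
      rw [hηdef]; field_simp; ring
    rw [h1]
    calc (t₁ - s) / (t - s) * (Y / 4) ≤ 1 * (Y / 4) := by
          gcongr
          exact (div_le_one hts).2 (by linarith [ht₁.2])
      _ = Y / 4 := one_mul _
  have hmain : (t₁ - s) * ((2 * η)⁻¹ * (∫ x, ‖f x‖ ^ 2)) ≤ (t - s) ^ 2 * ∫ x, ‖f x‖ ^ 2 := by
    rw [hη1]
    have h1 : t₁ - s ≤ t - s := by linarith [ht₁.2]
    have h2 : 0 ≤ t₁ - s := sub_nonneg.2 hst₁
    nlinarith [mul_le_mul_of_nonneg_right h1 (mul_nonneg hts.le hF0)]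
  have hYle : Y ≤ 2 * (∫ x, ‖U n s x‖ ^ 2) + 4 * (t - s) ^ 2 * ∫ x, ‖f x‖ ^ 2 := by
    have hW' : ∫ τ in s..t₁, ∫ x, ⟪(fun (_ : ℕ) (_ : ℝ) => f) n τ x, U n τ x⟫_ℝ ≤
        (t - s) ^ 2 * (∫ x, ‖f x‖ ^ 2) + Y / 4 := by
      rw [mul_add] at hW
      linarith
    linarith
  exact (hY t ⟨hst, le_rfl⟩).trans hYle

/-- **Taylor–Green, from rest, exact force: `∫ |U n t|² ≤ 2 ∫ |U n s|² + (t - s)²`** on `0 ≤ s ≤ t`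
(`∫ |f_TG|² = 1/4`). With `s = 0` this is (twice) the landed transient stub B′₁; its content is the case
`s > 0`: after ANY time at which the energy is low, it stays controlled for a ν-independent while. [folklore] -/
theorem tg_galerkin_excursion_le {ν : ℝ} (hν : 0 ≤ ν) {N : ℕ → ℕ}
    {U : ℕ → ℝ → UnitAddTorus (Fin 3) → EuclideanSpace ℝ (Fin 3)}
    (hS : IsHopfGalerkinScheme ν (fun _ => tgForce) 0 N (fun _ _ => tgForce) U) (n : ℕ) {s t : ℝ}
    (hs : 0 ≤ s) (hst : s ≤ t) :
    ∫ x, ‖U n t x‖ ^ 2 ≤ 2 * (∫ x, ‖U n s x‖ ^ 2) + (t - s) ^ 2 := by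
  have h := galerkin_excursion_le hS hν n hs hst
  rw [integral_norm_sq_tgForce] at h
  linarith

/-- **Recurrent returns give the late ceiling.** If, from some time `T₀ ≥ 0` on, the Galerkin energy of the
Taylor–Green flow from rest RETURNS below the level `E₁` at least once in every window of length `τ > 0`, then
it obeys the PATHWISE ceiling `2 E₁ + τ²` for all `t ≥ T₀ + τ` (uniformly in `ν ≥ 0` and in the order). So the
open stub `stub_galerkinLateCeilingFromRest` is, up to the constants `(E, T₀) ↦ (2E₁ + τ², T₀ + τ)`, a statement
about RECURRENCE of low-energy times, not about suprema. [folklore] -/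
theorem tg_lateCeiling_of_recurrentReturn {ν : ℝ} (hν : 0 ≤ ν) {N : ℕ → ℕ}
    {U : ℕ → ℝ → UnitAddTorus (Fin 3) → EuclideanSpace ℝ (Fin 3)}
    (hS : IsHopfGalerkinScheme ν (fun _ => tgForce) 0 N (fun _ _ => tgForce) U) (n : ℕ)
    {E₁ τ T₀ : ℝ} (hT₀ : 0 ≤ T₀)
    (hR : ∀ t, T₀ ≤ t → ∃ s ∈ Icc t (t + τ), ∫ x, ‖U n s x‖ ^ 2 ≤ E₁) :
    ∀ t, T₀ + τ ≤ t → ∫ x, ‖U n t x‖ ^ 2 ≤ 2 * E₁ + τ ^ 2 := by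
  intro t ht
  obtain ⟨s, hs, hsE⟩ := hR (t - τ) (by linarith)
  have hs0 : 0 ≤ s := by linarith [hs.1]
  have hst : s ≤ t := by linarith [hs.2]
  have hts : t - s ≤ τ := by linarith [hs.1]
  have hts0 : 0 ≤ t - s := sub_nonneg.2 hst
  calc ∫ x, ‖U n t x‖ ^ 2 ≤ 2 * (∫ x, ‖U n s x‖ ^ 2) + (t - s) ^ 2 := tg_galerkin_excursion_le hν hS n hs0 hst
    _ ≤ 2 * E₁ + τ ^ 2 := by gcongr

/-- Conversely (trivially), a late pathwise ceiling is a recurrent return with the same level: the two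
formulations of the open stub are equivalent up to constants. [folklore] -/
theorem tg_recurrentReturn_of_lateCeiling
    {U : ℕ → ℝ → UnitAddTorus (Fin 3) → EuclideanSpace ℝ (Fin 3)} (n : ℕ) {E T₀ τ : ℝ} (hτ : 0 ≤ τ)
    (hC : ∀ t, T₀ ≤ t → ∫ x, ‖U n t x‖ ^ 2 ≤ E) :
    ∀ t, T₀ ≤ t → ∃ s ∈ Icc t (t + τ), ∫ x, ‖U n s x‖ ^ 2 ≤ E :=
  fun t ht => ⟨t, ⟨le_rfl, le_add_of_nonneg_right hτ⟩, hC t ht⟩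

/-- **Windowed means give recurrent returns** (first-moment principle for the continuous slice energy): if the
window integral `∫_t^{t+τ} ∫ |U n s|² ds ≤ τ E₁`, some `s ∈ [t, t+τ]` has `∫ |U n s|² ≤ E₁`. Hence a ν-uniform
bound on WINDOWED TIME AVERAGES of the Galerkin energy after `T₀` already gives the pathwise late ceiling
(`tg_lateCeiling_of_recurrentReturn`). [folklore] -/
theorem galerkin_return_of_windowMean {ν : ℝ} {f : ℝ → UnitAddTorus d → EuclideanSpace ℝ d}
    {u₀ : UnitAddTorus d → EuclideanSpace ℝ d} {Nord : ℕ → ℕ} {F U : ℕ → ℝ → UnitAddTorus d → EuclideanSpace ℝ d}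
    (hS : IsHopfGalerkinScheme ν f u₀ Nord F U) (n : ℕ) {E₁ τ t : ℝ} (hτ : 0 < τ) (ht : 0 ≤ t)
    (hM : ∫ s in t..(t + τ), ∫ x, ‖U n s x‖ ^ 2 ≤ τ * E₁) :
    ∃ s ∈ Icc t (t + τ), ∫ x, ‖U n s x‖ ^ 2 ≤ E₁ := by
  by_contra h
  push Not at h
  have hyc : ContinuousOn (fun s => ∫ x, ‖U n s x‖ ^ 2) (Icc t (t + τ)) :=
    (Torus.continuousOn_integral_norm_sq_of_continuousOn_stLift (hS.continuousOn n)).mono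
      fun s hs => mem_Ici.2 (ht.trans hs.1)
  have hlt : ∫ s in t..(t + τ), (fun _ => E₁) s < ∫ s in t..(t + τ), ∫ x, ‖U n s x‖ ^ 2 :=
    intervalIntegral.integral_lt_integral_of_continuousOn_of_le_of_exists_lt (by linarith) continuousOn_const hyc
      (fun s hs => (h s ⟨hs.1.le, hs.2⟩).le) ⟨t, ⟨le_rfl, by linarith⟩, h t ⟨le_rfl, by linarith⟩⟩
  rw [intervalIntegral.integral_const, smul_eq_mul] at hlt
  linarith

end Galerkin

/-! ## §5 The full Taylor–Green group `G` (typed targets for the census' §Strengthen; NOT proved here)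

Numerically verified in kit jobs j024208 / j024250 (defects `1e-16`): the pinned force is fixed by the two extra
isometries below, the flow from rest stays in `Fix G`, and `Fix G` carries no divergence-free mode with
`|k|² ≤ 2` (the planar cell `(sin2πx₀ cos2πx₁, -cos2πx₀ sin2πx₁, 0)` is `h`-ODD), so that `f_TG` is the GRAVEST
`G`-mode and spans `Fix G ∩ {|k|² = 3}`. -/

section FullGroup

open Summit.AnomalousDissipation.AnomalousDissipation.Theorems.TaylorGreenLoudGalerkinStates.Negative (tgForce)

/-- The quarter turn about the vertical axis through `(1/4, 1/4, ·)`: `(g·u)(x) = Dg u(g⁻¹x)`,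
`g⁻¹ x = (x₁, 1/2 - x₀, x₂)`, `Dg v = (-v₁, v₀, v₂)` (Brachet et al. 1983, the rotational TG symmetry). -/
def gAct (u : UnitAddTorus (Fin 3) → EuclideanSpace ℝ (Fin 3)) :
    UnitAddTorus (Fin 3) → EuclideanSpace ℝ (Fin 3) := fun x =>
  !₂[-(u ![x 1, (((1 / 2 : ℝ)) : UnitAddCircle) - x 0, x 2] 1),
     u ![x 1, (((1 / 2 : ℝ)) : UnitAddCircle) - x 0, x 2] 0,
     u ![x 1, (((1 / 2 : ℝ)) : UnitAddCircle) - x 0, x 2] 2]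

/-- The half turn about the horizontal line `{x₀ = 1/4, x₂ = 1/4}`: `(h·u)(x) = Dh u(h x)`,
`h x = (1/2 - x₀, x₁, 1/2 - x₂)` (an involution), `Dh = diag(-1, 1, -1)`. -/
def hAct (u : UnitAddTorus (Fin 3) → EuclideanSpace ℝ (Fin 3)) :
    UnitAddTorus (Fin 3) → EuclideanSpace ℝ (Fin 3) := fun x =>
  !₂[-(u ![(((1 / 2 : ℝ)) : UnitAddCircle) - x 0, x 1, (((1 / 2 : ℝ)) : UnitAddCircle) - x 2] 0),
     u ![(((1 / 2 : ℝ)) : UnitAddCircle) - x 0, x 1, (((1 / 2 : ℝ)) : UnitAddCircle) - x 2] 1,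
     -(u ![(((1 / 2 : ℝ)) : UnitAddCircle) - x 0, x 1, (((1 / 2 : ℝ)) : UnitAddCircle) - x 2] 2)]

/-- Pointwise membership in `Fix G`: the three coordinate mirrors (the crux's `K`) plus `g` and `h`. -/
def IsGSymm (u : UnitAddTorus (Fin 3) → EuclideanSpace ℝ (Fin 3)) : Prop :=
  (∀ (i j : Fin 3) (x : UnitAddTorus (Fin 3)), u (Function.update x i (-x i)) j = if j = i then -(u x j) else u x j) ∧
    gAct u = u ∧ hAct u = u

/-- TARGET (provable now, M; the `Fix G` twin of the LANDED stub A `stub_mirrorSchemeFromRest`): for every `ν > 0`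
an exact-force Hopf–Galerkin scheme for `(ν, f_TG, 0)` all of whose slices are `G`-symmetric. Route: the
`G`-fixed coefficient subspace of every spherical/cubic Galerkin space is invariant under `galerkinRHS` because
`f_TG` is `G`-fixed (checked numerically to `1e-16`) and `G` acts by isometries of `T³`. -/
def FullSymmetricSchemeFromRest : Prop :=
  ∀ ν : ℝ, 0 < ν → ∃ (N : ℕ → ℕ) (U : ℕ → ℝ → UnitAddTorus (Fin 3) → EuclideanSpace ℝ (Fin 3)),
    IsHopfGalerkinScheme ν (fun _ => tgForce) 0 N (fun _ _ => tgForce) U ∧ ∀ (n : ℕ) (t : ℝ), 0 ≤ t → IsGSymm (U n t)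

/-- The heart in `Fix G` (S⁺_G of the census; OPEN — it is the live line's open stub with the two extra
symmetries as hypotheses): ν-uniform, resolution-uniform late energy ceiling for `G`-symmetric exact-force
Galerkin schemes of `NS_ν(f_TG)` from rest. Composes to the crux exactly as the birth line does
(`FullSymmetricSchemeFromRest`, the landed transient B′₁, this, the landed limit stub C — `G`-symmetric slices
are in particular `K`-symmetric). What the extra rigidity buys is recorded in the census (§Strengthen S-G):
exclusion of the planar-cell condensate and of every graver mode, a one-dimensional forcing shell — and NOT the
ceiling. -/
def LateCeilingFixG : Prop :=
  ∃ (E T₀ ν₁ : ℝ), 0 < E ∧ 0 ≤ T₀ ∧ 0 < ν₁ ∧ ∀ ν : ℝ, 0 < ν → ν < ν₁ → ∃ N₀ : ℕ,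
    ∀ (N : ℕ → ℕ) (U : ℕ → ℝ → UnitAddTorus (Fin 3) → EuclideanSpace ℝ (Fin 3)),
      IsHopfGalerkinScheme ν (fun _ => tgForce) 0 N (fun _ _ => tgForce) U →
      (∀ (n : ℕ) (t : ℝ), 0 ≤ t → IsGSymm (U n t)) →
      ∀ n : ℕ, N₀ ≤ N n → ∀ t : ℝ, T₀ ≤ t → ∫ x, ‖U n t x‖ ^ 2 ≤ E

/-- The RECURRENCE form of the heart (R of the census, §Decomposition D-R; OPEN, equivalent to the live open stub
up to constants by `tg_lateCeiling_of_recurrentReturn` / `tg_recurrentReturn_of_lateCeiling`): after `T₀` the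
Galerkin energy of the K-symmetric Taylor–Green flow from rest returns below `E₁` in every window of length `τ`. -/
def RecurrentReturnFromRest : Prop :=
  ∃ (E₁ τ T₀ ν₁ : ℝ), 0 < E₁ ∧ 0 < τ ∧ 0 ≤ T₀ ∧ 0 < ν₁ ∧ ∀ ν : ℝ, 0 < ν → ν < ν₁ → ∃ N₀ : ℕ,
    ∀ (N : ℕ → ℕ) (U : ℕ → ℝ → UnitAddTorus (Fin 3) → EuclideanSpace ℝ (Fin 3)),
      IsHopfGalerkinScheme ν (fun _ => tgForce) 0 N (fun _ _ => tgForce) U →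
      (∀ (n : ℕ) (t : ℝ), 0 ≤ t → ∀ (i j : Fin 3) (x : UnitAddTorus (Fin 3)),
        U n t (Function.update x i (-x i)) j = if j = i then -(U n t x j) else U n t x j) →
      ∀ n : ℕ, N₀ ≤ N n → ∀ t : ℝ, T₀ ≤ t → ∃ s ∈ Icc t (t + τ), ∫ x, ‖U n s x‖ ^ 2 ≤ E₁

/-- **R ⟹ the open stub in scheme form, verbatim** (`stub_galerkinLateCeilingFromRest` of `Lines/birth.lean` = the conclusion of
the lead's glue `lateCeiling_of_traj` and the hypothesis `hL` of `galerkinCeiling_of_transient_of_late`; since 2026-08-17T09:01Z the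
REGISTERED stub is its trajectory form `stub_galerkinLateCeilingTrajFromRest`), with `E = 2E₁ + τ²`, `T₀ + τ`. Kernel-checked reduction
of the heart to its recurrence form. -/
theorem stub_galerkinLateCeilingFromRest_of_recurrentReturn (hR : RecurrentReturnFromRest) :
    ∀ f : UnitAddTorus (Fin 3) → EuclideanSpace ℝ (Fin 3), f = (fun x => !₂[(fourier 1 (x 0) : ℂ).im * (fourier 1 (x 1) : ℂ).re * (fourier 1 (x 2) : ℂ).re, -((fourier 1 (x 0) : ℂ).re * (fourier 1 (x 1) : ℂ).im * (fourier 1 (x 2) : ℂ).re), (0 : ℝ)]) →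
      ∃ (E T₀ ν₁ : ℝ), 0 < E ∧ 0 ≤ T₀ ∧ 0 < ν₁ ∧ ∀ ν : ℝ, 0 < ν → ν < ν₁ → ∃ N₀ : ℕ,
        ∀ (N : ℕ → ℕ) (U : ℕ → ℝ → UnitAddTorus (Fin 3) → EuclideanSpace ℝ (Fin 3)),
          Literature.Analysis.FluidPDE.IsHopfGalerkinScheme ν (fun _ => f) 0 N (fun _ _ => f) U →
          (∀ (n : ℕ) (t : ℝ), 0 ≤ t → ∀ (i j : Fin 3) (x : UnitAddTorus (Fin 3)),
            U n t (Function.update x i (-x i)) j = if j = i then -(U n t x j) else U n t x j) →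
          ∀ n : ℕ, N₀ ≤ N n → ∀ t : ℝ, T₀ ≤ t → ∫ x, ‖U n t x‖ ^ 2 ≤ E := by
  intro f hf
  subst hf
  obtain ⟨E₁, τ, T₀, ν₁, hE₁, hτ, hT₀, hν₁, h⟩ := hR
  refine ⟨2 * E₁ + τ ^ 2, T₀ + τ, ν₁, by positivity, by positivity, hν₁, fun ν hν hνlt => ?_⟩
  obtain ⟨N₀, hN₀⟩ := h ν hν hνlt
  refine ⟨N₀, fun N U hS hsym n hn t ht => ?_⟩
  exact tg_lateCeiling_of_recurrentReturn hν.le hS n hT₀ (fun t' ht' => hN₀ N U hS hsym n hn t' ht') t ht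

end FullGroup

end Summit.AnomalousDissipation.AnomalousDissipation.Cruxes.MirrorBoundedFromRestTG.StrategyCensus
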